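import Summits.QuantumAdvantage.QuantumAdvantage.Theorems.CubicForrelationNearExactIsExactTwelveZ512SignAffine

/-!
# Crux `CubicForrelation.NearExactIsExact` (stmt-QuantumAdvantage-14043) — n = 12, a LEVEL-5 side below `29/32`: the odd hyperplane, the
  `4`-divisibility dichotomy off it, and (H3)/(H4) on it — partner-free bricks

Certificate seat `b2b-cforr-cert` (gen 27).  HONEST FRAMING: finite-slice lemmas (standard axioms) about cubic Boolean pairs on 12 bits; first bricks
for the level-5 branches of the open window `57/64 < Φ < 29/32` (after this generation only the pairings with both sides of type O or level 5
remain).  They hold WITHOUT the "exact off the hyperplane" hypothesis of gens 20–23.  NO value of `θ₁₂` claimed; NOT summit progress.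

Setting.  Cubic `f, g` on 12 bits, `W_g = 32u'` with some `u'` odd and some `u'` even (a level-5 side on the window: `Σ e₅² < 3584 < 4096`),
`e₅ := u' − 2(−1)^f` (odd exactly on `P := {u' odd}`, even off `P`).
* `tzl5_hyperplane`: `P = x₀ ⊕ V` with `V` xor-closed, `#V = 2048` (the parity `[u' odd]` is affine by the Walsh tower; Reed–Muller weight on
  it and on its complement; `mw_flat_of_minweight`).
* (gen 23, …TwelveLevelFiveCongruences: `l5c_flat4` / `l5c_flat5` — `4 ∣ Σ e₅` over every parametrised 4-flat, `8 ∣` over every 5-flat.)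
* `tzl5_A2_coset`, `tzl5_A2_energy`: `A₂ := {y ∉ P : 4 ∤ e₅(y)}` is empty or has `≥ 256` points (`ws_erm_round`, `r = 3` on the 11-dimensional
  off-coset); so EITHER `4 ∣ e₅` off `P` OR the off-hyperplane energy is `≥ 1024`.
* `tzl5_H3`: if `4 ∣ e₅` off `P` then `4 ∣ Σ_{3-flat ⊂ P} e₅` (a 4-flat `= 3`-flat `⊕ t`, no avoidance needed).
* `tzl5_H4`: if `4 ∣ e₅` off `P` and the off-hyperplane energy is `≤ 2047` (always, on the window) then `8 ∣ Σ_{4-flat ⊂ P} e₅` (one avoiding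
  direction: the `≤ 127` off-`P` points with `8 ∤ e₅` forbid `≤ 2048 + 16·127 = 4080 < 4096` vectors).

References: J. Ax (1964) / R. J. McEliece (1972); MacWilliams–Sloane (1977) Ch. 13 §3–4; R. O'Donnell (2014) §3.3.  Axioms: the standard three.
-/

set_option linter.dupNamespace false -- D-0017: single-problem summit ⇒ `QuantumAdvantage.QuantumAdvantage` by design

noncomputable section

namespace Summit.QuantumAdvantage.QuantumAdvantage.Theorems.CubicForrelation.NearExactIsExact

open Finset
open Literature.Computability.QuantumComplexity
open Literature.Computability.QuantumComplexity.BuzetChailloux (bxor zeroVec bxor_bxor_cancel_left bxor_zeroVec zeroVec_bxor bxor_comm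
  bxor_self)
open Literature.Computability.QuantumComplexity.DerivativeWalsh (W)

/-! ### The odd hyperplane -/

/-- **The odd set of a level-5 side is an affine hyperplane**: cubic `g`, `W_g = 32u'`, some `u'` odd and some `u'` even ⇒
`{u' odd} = x₀ ⊕ V` with `V ∋ 0` xor-closed of size `2048`. [this work] -/
theorem tzl5_hyperplane (g : (Fin (6 + 6) → Bool) → Bool) (hg : IsDegLeFun 3 g)
    (u' : (Fin (6 + 6) → Bool) → ℤ) (hu' : ∀ x, W (fun y => signOf (g y)) x = (2 : ℝ) ^ 5 * (u' x : ℝ))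
    (hodd : ∃ x, Odd (u' x)) (hev : ∃ x, ¬ Odd (u' x)) :
    ∃ (V : Finset (Fin (6 + 6) → Bool)) (x₀ : Fin (6 + 6) → Bool), zeroVec ∈ V ∧ (∀ a ∈ V, ∀ b ∈ V, bxor a b ∈ V) ∧ #V = 2048 ∧
      (univ.filter fun x : Fin (6 + 6) → Bool => Odd (u' x)) = V.image (bxor x₀) := by
  classical
  have hdeg : IsDegLeFun 1 (fun x => decide (Odd (u' x))) :=
    stub_walshTower stub_axParity (6 + 6) 5 1 g u' hg hu' (by intro k hk hkn; omega)
  have hdeg' : IsDegLeFun 1 (fun x => decide (Odd (u' x)) ^^ true) := tb_isDegLeFun_xor_const hdeg true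
  obtain ⟨x₀, hx₀⟩ := hodd
  obtain ⟨x₁, hx₁⟩ := hev
  have hfilt : (univ.filter fun x : Fin (6 + 6) → Bool => decide (Odd (u' x)) = true) = univ.filter (fun x => Odd (u' x)) :=
    filter_congr fun x _ => by simp
  have hfilt' : (univ.filter fun x : Fin (6 + 6) → Bool => (decide (Odd (u' x)) ^^ true) = true) = univ.filter (fun x => ¬ Odd (u' x)) :=
    filter_congr fun x _ => by rw [Int.not_odd_iff_even]; simp
  have h1 := bb_rmWeight_holds (6 + 6) 1 _ hdeg ⟨x₀, decide_eq_true hx₀⟩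
  have h2 := bb_rmWeight_holds (6 + 6) 1 _ hdeg' ⟨x₁, by simpa using hx₁⟩
  rw [hfilt] at h1
  rw [hfilt'] at h2
  have htot : #(univ.filter fun x : Fin (6 + 6) → Bool => Odd (u' x)) + #(univ.filter fun x : Fin (6 + 6) → Bool => ¬ Odd (u' x)) = 4096 := by
    rw [Finset.card_filter_add_card_filter_not, card_univ, Fintype.card_fun, Fintype.card_bool, Fintype.card_fin]; norm_num
  have hP : #(univ.filter fun x : Fin (6 + 6) → Bool => Odd (u' x)) = 2048 := by norm_num at h1 h2 htot ⊢; omega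
  have hmw := mw_flat_of_minweight 0 (fun x => decide (Odd (u' x))) hdeg (by rw [hfilt, hP]; norm_num)
  rw [hfilt] at hmw
  obtain ⟨h0, hadd, hcardV, hcoset⟩ := hmw
  refine ⟨_, x₀, h0, hadd, by rw [hcardV, hP], hcoset x₀ (decide_eq_true hx₀)⟩

/-! ### Off the hyperplane: `4 ∣ e₅` or energy `≥ 1024` -/

/-- **`A₂ = {y ∉ P : 4 ∤ e₅}` is empty or has `≥ 256` points** (the off-coset `c ⊕ V` is the complement of `P`). [this work] -/
theorem tzl5_A2_coset (f g : (Fin (6 + 6) → Bool) → Bool) (hf : IsDegLeFun 3 f) (hg : IsDegLeFun 3 g)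
    (u' : (Fin (6 + 6) → Bool) → ℤ) (hu' : ∀ x, W (fun y => signOf (g y)) x = (2 : ℝ) ^ 5 * (u' x : ℝ))
    (V : Finset (Fin (6 + 6) → Bool)) (x₀ : Fin (6 + 6) → Bool) (h0 : zeroVec ∈ V) (hadd : ∀ a ∈ V, ∀ b ∈ V, bxor a b ∈ V)
    (hcardV : #V = 2048) (hP : (univ.filter fun x : Fin (6 + 6) → Bool => Odd (u' x)) = V.image (bxor x₀))
    (c : Fin (6 + 6) → Bool) (hc : ¬ Odd (u' c)) :
    (∀ y ∈ V.image (bxor c), (4 : ℤ) ∣ u' y - 2 * sZ (f y)) ∨ 256 ≤ #((V.image (bxor c)).filter fun y => ¬ (4 : ℤ) ∣ u' y - 2 * sZ (f y)) := by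
  classical
  set P := univ.filter (fun x : Fin (6 + 6) → Bool => Odd (u' x)) with hPdef
  set e : (Fin (6 + 6) → Bool) → ℤ := fun x => u' x - 2 * sZ (f x) with hedef
  have hcardV11 : #V = 2 ^ 11 := by rw [hcardV]; norm_num
  have hcP : c ∉ P := fun h => hc (mem_filter.1 h).2
  have hPV' : ∀ x, x ∉ P → ∀ a ∈ V, bxor x a ∉ P := fun x hx a ha => fl1_coset_out' hadd hP hx ha
  have hcos_out : ∀ b ∈ V.image (bxor c), b ∉ P := by
    intro b hb
    obtain ⟨v, hv, rfl⟩ := mem_image.1 hb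
    exact hPV' c hcP v hv
  have heven : ∀ y, y ∉ P → Even (e y) := by
    intro y hy
    have hy' : ¬ Odd (u' y) := fun h => hy (mem_filter.2 ⟨mem_univ _, h⟩)
    obtain ⟨m, hm⟩ := Int.not_odd_iff_even.1 hy'
    exact ⟨m - sZ (f y), by simp only [e]; rw [hm]; ring⟩
  have hp2 : ∀ y, y ∉ P → e y = 2 * (e y / 2) := fun y hy =>
    (Int.mul_ediv_cancel' (even_iff_two_dvd.1 (heven y hy))).symm
  rcases ws_erm_round V h0 hadd hcardV11 c (fun y => e y / 2) 3 (fun b hb a ha => by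
      have hpts : ∀ ε : Fin (3 + 1) → Bool, (fun j => b j ^^ decide (Odd #(univ.filter fun i => ε i && a i j))) ∉ P :=
        fun ε => ws_flatPt_mem V h0 (· ∉ P) hPV' (3 + 1) b (hcos_out b hb) a ha ε
      have h4 : (4 : ℤ) ∣ ∑ ε : Fin (3 + 1) → Bool, e (fun j => b j ^^ decide (Odd #(univ.filter fun i => ε i && a i j))) :=
        l5c_flat4 f g hf hg u' hu' b a
      rw [sum_congr rfl fun ε _ => hp2 _ (hpts ε), ← mul_sum] at h4
      obtain ⟨k, hk⟩ := h4
      exact ⟨k, by linarith⟩) with hall | hbig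
  · left
    intro y hy
    obtain ⟨k, hk⟩ := hall y hy
    have h2 := hp2 y (hcos_out y hy)
    refine ⟨k, ?_⟩
    simp only [e] at hk h2
    omega
  · right
    show 256 ≤ #((V.image (bxor c)).filter fun y => ¬ (4 : ℤ) ∣ e y)
    have e1 : ((V.image (bxor c)).filter fun x => Odd (e x / 2)) = (V.image (bxor c)).filter fun y => ¬ (4 : ℤ) ∣ e y := by
      refine filter_congr fun y hy => ?_
      have h2 := hp2 y (hcos_out y hy)
      constructor
      · intro hodd h4
        obtain ⟨k, hk⟩ := h4
        rw [Int.odd_iff] at hodd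
        omega
      · intro h4
        rw [Int.odd_iff]
        by_contra hne
        exact h4 ⟨e y / 2 / 2, by omega⟩
    rw [e1] at hbig
    norm_num at hbig
    omega

/-- **Dichotomy off the hyperplane**: EITHER `4 ∣ e₅` everywhere off `P`, OR the off-hyperplane energy is `≥ 1024` (`256` points with `e₅ ≡ 2
(mod 4)`, each of cost `≥ 4`). [this work] -/
theorem tzl5_A2_energy (f g : (Fin (6 + 6) → Bool) → Bool) (hf : IsDegLeFun 3 f) (hg : IsDegLeFun 3 g)
    (u' : (Fin (6 + 6) → Bool) → ℤ) (hu' : ∀ x, W (fun y => signOf (g y)) x = (2 : ℝ) ^ 5 * (u' x : ℝ))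
    (V : Finset (Fin (6 + 6) → Bool)) (x₀ : Fin (6 + 6) → Bool) (h0 : zeroVec ∈ V) (hadd : ∀ a ∈ V, ∀ b ∈ V, bxor a b ∈ V)
    (hcardV : #V = 2048) (hP : (univ.filter fun x : Fin (6 + 6) → Bool => Odd (u' x)) = V.image (bxor x₀)) :
    (∀ y, ¬ Odd (u' y) → (4 : ℤ) ∣ u' y - 2 * sZ (f y)) ∨
      1024 ≤ ∑ y ∈ univ.filter (fun y : Fin (6 + 6) → Bool => ¬ Odd (u' y)), (u' y - 2 * sZ (f y)) ^ 2 := by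
  classical
  set e : (Fin (6 + 6) → Bool) → ℤ := fun x => u' x - 2 * sZ (f x) with hedef
  by_cases hall : ∀ y, ¬ Odd (u' y) → (4 : ℤ) ∣ e y
  · exact Or.inl hall
  right
  push Not at hall
  obtain ⟨c, hc, hc4⟩ := hall
  set P := univ.filter (fun x : Fin (6 + 6) → Bool => Odd (u' x)) with hPdef
  have hcP : c ∉ P := fun h => hc (mem_filter.1 h).2
  have hPV' : ∀ x, x ∉ P → ∀ a ∈ V, bxor x a ∉ P := fun x hx a ha => fl1_coset_out' hadd hP hx ha
  rcases tzl5_A2_coset f g hf hg u' hu' V x₀ h0 hadd hcardV hP c hc with h4 | hbig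
  · exact absurd (h4 c (mem_image.2 ⟨zeroVec, h0, bxor_zeroVec c⟩)) hc4
  · set M := (V.image (bxor c)).filter (fun y => ¬ (4 : ℤ) ∣ e y) with hMdef
    have hMsub : M ⊆ univ.filter (fun y : Fin (6 + 6) → Bool => ¬ Odd (u' y)) := by
      intro y hy
      obtain ⟨hy1, -⟩ := mem_filter.1 hy
      obtain ⟨v, hv, rfl⟩ := mem_image.1 hy1
      exact mem_filter.2 ⟨mem_univ _, fun h => hPV' c hcP v hv (mem_filter.2 ⟨mem_univ _, h⟩)⟩
    have hcost : ∀ y ∈ M, (4 : ℤ) ≤ e y ^ 2 := by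
      intro y hy
      obtain ⟨hy1, hy4⟩ := mem_filter.1 hy
      have hyP : ¬ Odd (u' y) := (mem_filter.1 (hMsub hy)).2
      obtain ⟨m, hm⟩ := Int.not_odd_iff_even.1 hyP
      have hev : e y = 2 * (m - sZ (f y)) := by simp only [e]; rw [hm]; ring
      have hm0 : m - sZ (f y) ≠ 0 := by
        intro h0
        apply hy4
        rw [hev, h0, mul_zero]; exact dvd_zero 4
      have : e y ≤ -2 ∨ 2 ≤ e y := by omega
      have := tp_sq_ge (k := 2) (by norm_num) this
      linarith
    have h256 : (256 : ℤ) ≤ #M := by exact_mod_cast hbig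
    calc (1024 : ℤ) ≤ 4 * #M := by linarith
      _ = ∑ y ∈ M, (4 : ℤ) := by rw [sum_const, nsmul_eq_mul, mul_comm]
      _ ≤ ∑ y ∈ M, e y ^ 2 := sum_le_sum hcost
      _ ≤ ∑ y ∈ univ.filter (fun y : Fin (6 + 6) → Bool => ¬ Odd (u' y)), e y ^ 2 :=
          sum_le_sum_of_subset_of_nonneg hMsub fun _ _ _ => sq_nonneg _

/-! ### (H3) and (H4) on the hyperplane when `4 ∣ e₅` off it -/

/-- **(H3) on `P`**: if `4 ∣ e₅` off `P` then `4 ∣ Σ_{3-flat ⊂ P} e₅` (base in `P`, directions in `V`; the 4-flat `x ⊕ ⟨a,b,c,t⟩` with any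
`t ∉ V` has sum `≡ 0 (mod 4)` and its `t`-half lies off `P`). [this work] -/
theorem tzl5_H3 (f g : (Fin (6 + 6) → Bool) → Bool) (hf : IsDegLeFun 3 f) (hg : IsDegLeFun 3 g)
    (u' : (Fin (6 + 6) → Bool) → ℤ) (hu' : ∀ x, W (fun y => signOf (g y)) x = (2 : ℝ) ^ 5 * (u' x : ℝ))
    (V : Finset (Fin (6 + 6) → Bool)) (x₀ : Fin (6 + 6) → Bool) (h0 : zeroVec ∈ V) (hadd : ∀ a ∈ V, ∀ b ∈ V, bxor a b ∈ V)
    (hcardV : #V = 2048) (hP : (univ.filter fun x : Fin (6 + 6) → Bool => Odd (u' x)) = V.image (bxor x₀))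
    (h4off : ∀ y, ¬ Odd (u' y) → (4 : ℤ) ∣ u' y - 2 * sZ (f y))
    (x : Fin (6 + 6) → Bool) (hx : Odd (u' x)) (a b c : Fin (6 + 6) → Bool) (ha : a ∈ V) (hb : b ∈ V) (hc : c ∈ V) :
    (4 : ℤ) ∣ ∑ ε : Fin 3 → Bool, (u' (fun j => x j ^^ decide (Odd #(univ.filter fun i =>
        ε i && (![a, b, c] : Fin 3 → Fin (6 + 6) → Bool) i j))) - 2 * sZ (f (fun j => x j ^^ decide (Odd #(univ.filter fun i =>
        ε i && (![a, b, c] : Fin 3 → Fin (6 + 6) → Bool) i j))))) := by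
  classical
  set P := univ.filter (fun x : Fin (6 + 6) → Bool => Odd (u' x)) with hPdef
  set e : (Fin (6 + 6) → Bool) → ℤ := fun x => u' x - 2 * sZ (f x) with hedef
  have hxP : x ∈ P := mem_filter.2 ⟨mem_univ _, hx⟩
  have hPV : ∀ x, x ∈ P → ∀ a ∈ V, bxor x a ∈ P := fun x hx a ha => fl1_coset_vadd hadd hP hx ha
  -- a transversal vector `t ∉ V`
  have huniv : #(univ : Finset (Fin (6 + 6) → Bool)) = 4096 := by
    rw [card_univ, Fintype.card_fun, Fintype.card_bool, Fintype.card_fin]; norm_num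
  obtain ⟨t, -, ht⟩ : ∃ t, t ∈ univ ∧ t ∉ V := exists_mem_notMem_of_card_lt_card (by rw [huniv, hcardV]; norm_num)
  have h4 := l5c_flat4 f g hf hg u' hu' x ![t, a, b, c]
  have e4 : (![t, a, b, c] : Fin 4 → Fin (6 + 6) → Bool) = Matrix.vecCons t ![a, b, c] := rfl
  change (4 : ℤ) ∣ ∑ ε : Fin 4 → Bool, e (fun j => x j ^^ decide (Odd #(univ.filter fun i =>
        ε i && (![t, a, b, c] : Fin 4 → Fin (6 + 6) → Bool) i j))) at h4
  rw [e4, fr_sum_peel e x t ![a, b, c]] at h4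
  have hin : ∀ ε : Fin 3 → Bool, (fun j => x j ^^ decide (Odd #(univ.filter fun i =>
      ε i && (![a, b, c] : Fin 3 → Fin (6 + 6) → Bool) i j))) ∈ P :=
    fun ε => fr_mem_flatPt3 V h0 (· ∈ P) hPV hxP ![a, b, c] (fun i => by fin_cases i <;> assumption) ε
  have hout : ∀ ε : Fin 3 → Bool, (4 : ℤ) ∣ e (bxor (fun j => x j ^^ decide (Odd #(univ.filter fun i =>
      ε i && (![a, b, c] : Fin 3 → Fin (6 + 6) → Bool) i j))) t) := by
    intro ε
    have hnot : bxor (fun j => x j ^^ decide (Odd #(univ.filter fun i =>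
        ε i && (![a, b, c] : Fin 3 → Fin (6 + 6) → Bool) i j))) t ∉ P := fl1_coset_out h0 hadd hP (hin ε) ht
    exact h4off _ (fun h => hnot (mem_filter.2 ⟨mem_univ _, h⟩))
  have hsum := dvd_sum fun ε (_ : ε ∈ (univ : Finset (Fin 3 → Bool))) => hout ε
  have h := dvd_sub h4 hsum
  rwa [add_sub_cancel_right] at h

/-- **(H4) on `P`**: if `4 ∣ e₅` off `P` and the off-hyperplane energy is `≤ 2047`, then `8 ∣ Σ_{4-flat ⊂ P} e₅` (the 5-flat `x ⊕ ⟨t, a₀..a₃⟩`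
for one direction `t` whose 16 translates avoid `P` and the `≤ 127` off-`P` points with `8 ∤ e₅`). [this work] -/
theorem tzl5_H4 (f g : (Fin (6 + 6) → Bool) → Bool) (hf : IsDegLeFun 3 f) (hg : IsDegLeFun 3 g)
    (u' : (Fin (6 + 6) → Bool) → ℤ) (hu' : ∀ x, W (fun y => signOf (g y)) x = (2 : ℝ) ^ 5 * (u' x : ℝ))
    (V : Finset (Fin (6 + 6) → Bool)) (x₀ : Fin (6 + 6) → Bool) (h0 : zeroVec ∈ V) (hadd : ∀ a ∈ V, ∀ b ∈ V, bxor a b ∈ V)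
    (hcardV : #V = 2048) (hP : (univ.filter fun x : Fin (6 + 6) → Bool => Odd (u' x)) = V.image (bxor x₀))
    (h4off : ∀ y, ¬ Odd (u' y) → (4 : ℤ) ∣ u' y - 2 * sZ (f y))
    (hoff : ∑ y ∈ univ.filter (fun y : Fin (6 + 6) → Bool => ¬ Odd (u' y)), (u' y - 2 * sZ (f y)) ^ 2 ≤ 2047)
    (x : Fin (6 + 6) → Bool) (hx : Odd (u' x)) (a₀ a₁ a₂ a₃ : Fin (6 + 6) → Bool) (ha₀ : a₀ ∈ V) (ha₁ : a₁ ∈ V) (ha₂ : a₂ ∈ V) (ha₃ : a₃ ∈ V) :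
    (8 : ℤ) ∣ ∑ ε : Fin 4 → Bool, (u' (fun j => x j ^^ decide (Odd #(univ.filter fun i =>
        ε i && (![a₀, a₁, a₂, a₃] : Fin 4 → Fin (6 + 6) → Bool) i j))) - 2 * sZ (f (fun j => x j ^^ decide (Odd #(univ.filter fun i =>
        ε i && (![a₀, a₁, a₂, a₃] : Fin 4 → Fin (6 + 6) → Bool) i j))))) := by
  classical
  set P := univ.filter (fun x : Fin (6 + 6) → Bool => Odd (u' x)) with hPdef
  set e : (Fin (6 + 6) → Bool) → ℤ := fun x => u' x - 2 * sZ (f x) with hedef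
  have hxP : x ∈ P := mem_filter.2 ⟨mem_univ _, hx⟩
  have hPV : ∀ x, x ∈ P → ∀ a ∈ V, bxor x a ∈ P := fun x hx a ha => fl1_coset_vadd hadd hP hx ha
  have h4off' : ∀ y, y ∉ P → (4 : ℤ) ∣ e y := fun y hy => h4off y (fun h => hy (mem_filter.2 ⟨mem_univ _, h⟩))
  -- the bad set `A₈ = {y ∉ P : 8 ∤ e₅}` has `≤ 127` points (each costs `≥ 16`)
  set A := (univ.filter fun y : Fin (6 + 6) → Bool => ¬ Odd (u' y) ∧ ¬ (8 : ℤ) ∣ u' y - 2 * sZ (f y)) with hAdef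
  have hAcard : #A ≤ 127 := by
    have hcost : ∀ y ∈ A, (16 : ℤ) ≤ e y ^ 2 := by
      intro y hy
      obtain ⟨hyP, hy8⟩ := (mem_filter.1 hy).2
      obtain ⟨m, hm⟩ := h4off y hyP
      have hm0 : ¬ (2 : ℤ) ∣ m := by
        rintro ⟨m', rfl⟩
        exact hy8 ⟨m', by rw [hm]; ring⟩
      have : e y ≤ -4 ∨ 4 ≤ e y := by change u' y - 2 * sZ (f y) ≤ -4 ∨ 4 ≤ u' y - 2 * sZ (f y); omega
      have := tp_sq_ge (k := 4) (by norm_num) this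
      linarith
    have hAsub : A ⊆ univ.filter (fun y : Fin (6 + 6) → Bool => ¬ Odd (u' y)) := fun y hy => mem_filter.2 ⟨mem_univ _, (mem_filter.1 hy).2.1⟩
    have h16 : (16 : ℤ) * #A ≤ 2047 := by
      calc (16 : ℤ) * #A = ∑ y ∈ A, (16 : ℤ) := by rw [sum_const, nsmul_eq_mul, mul_comm]
        _ ≤ ∑ y ∈ A, e y ^ 2 := sum_le_sum hcost
        _ ≤ ∑ y ∈ univ.filter (fun y : Fin (6 + 6) → Bool => ¬ Odd (u' y)), e y ^ 2 :=
            sum_le_sum_of_subset_of_nonneg hAsub fun _ _ _ => sq_nonneg _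
        _ ≤ 2047 := hoff
    have : (#A : ℤ) ≤ 127 := by omega
    exact_mod_cast this
  -- the inner 4-flat and ONE avoiding direction
  set pt : (Fin 4 → Bool) → (Fin (6 + 6) → Bool) :=
    fun ε => (fun j => x j ^^ decide (Odd #(univ.filter fun i => ε i && (![a₀, a₁, a₂, a₃] : Fin 4 → Fin (6 + 6) → Bool) i j))) with hptdef
  have hin : ∀ ε, pt ε ∈ P := fun ε => fr_mem_flatPt4 V h0 (· ∈ P) hPV hxP ![a₀, a₁, a₂, a₃] (fun i => by fin_cases i <;> assumption) ε
  set Bad₀ := (univ : Finset (Fin 4 → Bool)).biUnion (fun ε => A.image (bxor (pt ε))) with hBad₀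
  have hBad₀card : #Bad₀ ≤ 2032 := by
    calc #Bad₀ ≤ ∑ ε : Fin 4 → Bool, #(A.image (bxor (pt ε))) := card_biUnion_le
      _ ≤ ∑ ε : Fin 4 → Bool, #A := sum_le_sum fun ε _ => card_image_le
      _ = 2 ^ 4 * #A := by rw [sum_const, card_univ, Fintype.card_fun, Fintype.card_bool, Fintype.card_fin, smul_eq_mul]
      _ ≤ 16 * 127 := Nat.mul_le_mul (le_refl _) hAcard
      _ = 2032 := by norm_num
  set F₁ := V ∪ Bad₀ with hF₁
  have hF₁card : #F₁ ≤ 4080 := (card_union_le _ _).trans (by rw [hcardV]; omega)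
  have huniv : #(univ : Finset (Fin (6 + 6) → Bool)) = 4096 := by
    rw [card_univ, Fintype.card_fun, Fintype.card_bool, Fintype.card_fin]; norm_num
  obtain ⟨t, -, ht⟩ : ∃ t, t ∈ univ ∧ t ∉ F₁ := exists_mem_notMem_of_card_lt_card (by rw [huniv]; omega)
  rw [hF₁, mem_union, not_or] at ht
  have hgood : ∀ ε, bxor (pt ε) t ∉ P ∧ bxor (pt ε) t ∉ A := by
    intro ε
    refine ⟨fl1_coset_out h0 hadd hP (hin ε) ht.1, fun h => ht.2 ?_⟩
    exact mem_biUnion.2 ⟨ε, mem_univ _, mem_image.2 ⟨bxor (pt ε) t, h, bxor_bxor_cancel_left _ _⟩⟩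
  have hout : ∀ ε, (8 : ℤ) ∣ e (bxor (pt ε) t) := by
    intro ε
    obtain ⟨hnP, hnA⟩ := hgood ε
    by_contra h8
    exact hnA (mem_filter.2 ⟨mem_univ _, fun h => hnP (mem_filter.2 ⟨mem_univ _, h⟩), h8⟩)
  -- the 5-flat `x ⊕ ⟨t, a₀..a₃⟩`
  have h5 := l5c_flat5 f g hf hg u' hu' x ![t, a₀, a₁, a₂, a₃]
  have e5 : (![t, a₀, a₁, a₂, a₃] : Fin 5 → Fin (6 + 6) → Bool) = Matrix.vecCons t ![a₀, a₁, a₂, a₃] := rfl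
  change (8 : ℤ) ∣ ∑ ε : Fin 5 → Bool, e (fun j => x j ^^ decide (Odd #(univ.filter fun i =>
        ε i && (![t, a₀, a₁, a₂, a₃] : Fin 5 → Fin (6 + 6) → Bool) i j))) at h5
  rw [e5, fr_sum_peel e x t ![a₀, a₁, a₂, a₃]] at h5
  have hsum := dvd_sum fun ε (_ : ε ∈ (univ : Finset (Fin 4 → Bool))) => hout ε
  have h := dvd_sub h5 hsum
  rwa [add_sub_cancel_right] at h

end Summit.QuantumAdvantage.QuantumAdvantage.Theorems.CubicForrelation.NearExactIsExact

end
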